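import Literature.NumberTheory.EllipticCurves.UnrIntegersUnits
import Summits.BirchSwinnertonDyer.Rank1Residual.X11b.HalvesReceptacle
import HarnessLib

/-!
# UTD crux #2 `ToricTransportModThree` (stmt-BirchSwinnertonDyer-20186) — the closing algebra of any
# invariants-transport line: divisibility + norm profile ⇒ equality of principal ideals of `R₀⟦T⟧`

Helper for route `UniversalToricDescent`, crux `ToricTransportModThree` (lead prover bsd-wall-utd-p1 g2,
`--supports stmt-BirchSwinnertonDyer-20186`). Pure algebra in `Λ_{R₀} = R₀⟦T⟧ = UnrSeries p`
(`R₀ = unrIntegers p ⊂ ℂ_p`), no elliptic curve enters.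

The crux concludes an EQUALITY `Ch_Λ(X_{∅,0}(E/K_∞))·R₀⟦T⟧ = (L)` of principal ideals of `R₀⟦T⟧`. Congruence
technology (Greenberg–Vatsal 2000, Emerton–Pollack–Weston 2006, Lei–Müller–Xia 2023) transports only the
Iwasawa INVARIANTS `(μ, λ)` of the two sides; an equality then needs ONE inclusion plus the elementary step proved
here, in the NORM currency of `ℂ_p` (no residue field or DVR structure on `R₀` is used; only `R₀ ⊆ {‖·‖ ≤ 1}`
and `R₀ˣ = {‖·‖ = 1}`, `unrIntegers.isUnit_iff_norm_eq_one`):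

* `span_eq_span_of_dvd_of_normProfile`: if `g ∣ L` in `R₀⟦T⟧`, `g` has no coefficient of norm `1` in degrees
  `< n` ("`λ(g) ≥ n` or `μ(g) > 0`") and `‖L_n‖ = 1` ("`μ(L) = 0` and `λ(L) ≤ n`"), then `(g) = (L)` — writing
  `L = g·q`, the degree-`n` coefficient of `L` is `g_n q_0` plus terms of norm `< 1`, so `‖q_0‖ = 1` by the
  ultrametric inequality and `q` is a unit;
* `eq_span_of_span_le_of_normProfile`: the same in the shape the crux uses — an ideal `I = (g)` with `(L) ≤ I` and
  the two profile conditions equals `(L)`.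

References: Greenberg–Vatsal, Invent. Math. 142 (2000) §1 (the `(μ, λ)`-transport); Washington, GTM 83, §7.1
(units of `A⟦T⟧`). The statements are folklore.
-/

noncomputable section

open scoped Classical

set_option linter.dupNamespace false

namespace Summit.BirchSwinnertonDyer.BirchSwinnertonDyer.Theorems.UniversalToricDescentNormProfile

open Literature.NumberTheory.EllipticCurves PowerSeries

variable {p : ℕ} [Fact p.Prime]

/-- Coefficients of an element of `R₀⟦T⟧` have norm `≤ 1` in `ℂ_p` (`R₀ ⊆ {‖·‖ ≤ 1}`). [folklore] -/
theorem norm_coeff_le_one (q : UnrSeries p) (j : ℕ) :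
    ‖((PowerSeries.coeff j q : unrIntegers p) : ℂ_[p])‖ ≤ 1 :=
  Summit.BirchSwinnertonDyer.Rank1Residual.X11b.Halves.norm_coe_unrIntegers_le_one p _

/-- **Divisibility + norm profile ⇒ equality of principal ideals of `R₀⟦T⟧`.** If `g ∣ L`, `g` has no
coefficient of norm `1` in degrees `< n`, and `‖L_n‖ = 1`, then `(g) = (L)`: with `L = g·q`, the degree-`n`
coefficient of `L` is `g_n q_0` plus terms of norm `< 1`, so `‖q_0‖ = 1` (ultrametric), `q_0 ∈ R₀ˣ`
(`unrIntegers.isUnit_iff_norm_eq_one`) and `q ∈ R₀⟦T⟧ˣ`. This is the step that turns "one inclusion + equal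
`(μ, λ)`" into the main-conjecture equality. [folklore] -/
theorem span_eq_span_of_dvd_of_normProfile {g L : UnrSeries p} {n : ℕ} (hdvd : g ∣ L)
    (hg : ∀ i < n, ‖((PowerSeries.coeff i g : unrIntegers p) : ℂ_[p])‖ < 1)
    (hL : ‖((PowerSeries.coeff n L : unrIntegers p) : ℂ_[p])‖ = 1) :
    Ideal.span ({g} : Set (UnrSeries p)) = Ideal.span {L} := by
  obtain ⟨q, rfl⟩ := hdvd
  have hq0 : ‖((PowerSeries.constantCoeff q : unrIntegers p) : ℂ_[p])‖ = 1 := by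
    by_contra hne
    have hlt : ‖((PowerSeries.constantCoeff q : unrIntegers p) : ℂ_[p])‖ < 1 :=
      lt_of_le_of_ne (by simpa using norm_coeff_le_one q 0) hne
    let F : ℕ × ℕ → ℂ_[p] := fun ij ↦
      ((PowerSeries.coeff ij.1 g * PowerSeries.coeff ij.2 q : unrIntegers p) : ℂ_[p])
    have hterm : ∀ ij ∈ Finset.HasAntidiagonal.antidiagonal n, ‖F ij‖ < 1 := by
      intro ij hij
      rw [Finset.HasAntidiagonal.mem_antidiagonal] at hij
      simp only [F, Subring.coe_mul, norm_mul]
      rcases Nat.lt_or_ge ij.1 n with h1 | h1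
      · calc ‖((PowerSeries.coeff ij.1 g : unrIntegers p) : ℂ_[p])‖ *
              ‖((PowerSeries.coeff ij.2 q : unrIntegers p) : ℂ_[p])‖
            ≤ ‖((PowerSeries.coeff ij.1 g : unrIntegers p) : ℂ_[p])‖ * 1 :=
              mul_le_mul_of_nonneg_left (norm_coeff_le_one q _) (norm_nonneg _)
          _ < 1 := by rw [mul_one]; exact hg _ h1
      · have h2 : ij.2 = 0 := by omega
        rw [h2]
        calc ‖((PowerSeries.coeff ij.1 g : unrIntegers p) : ℂ_[p])‖ *
              ‖((PowerSeries.coeff 0 q : unrIntegers p) : ℂ_[p])‖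
            ≤ 1 * ‖((PowerSeries.coeff 0 q : unrIntegers p) : ℂ_[p])‖ :=
              mul_le_mul_of_nonneg_right (norm_coeff_le_one g _) (norm_nonneg _)
          _ < 1 := by rw [one_mul]; simpa using hlt
    have hsum : ‖((PowerSeries.coeff n (g * q) : unrIntegers p) : ℂ_[p])‖ < 1 := by
      have hcoe : ((PowerSeries.coeff n (g * q) : unrIntegers p) : ℂ_[p]) =
          ∑ ij ∈ Finset.HasAntidiagonal.antidiagonal n, F ij := by
        rw [PowerSeries.coeff_mul]
        exact map_sum (unrIntegers p).subtype _ _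
      rw [hcoe]
      have hne : (Finset.HasAntidiagonal.antidiagonal n).Nonempty := ⟨(0, n), by simp⟩
      obtain ⟨ij, hij, hle⟩ := IsUltrametricDist.exists_norm_finsetSum_le_of_nonempty hne F
      exact lt_of_le_of_lt hle (hterm ij hij)
    exact absurd hL (ne_of_lt hsum)
  have hunit : IsUnit q := by
    rw [PowerSeries.isUnit_iff_constantCoeff]
    exact (unrIntegers.isUnit_iff_norm_eq_one _).mpr hq0
  obtain ⟨u, hu⟩ := hunit
  apply Ideal.span_singleton_eq_span_singleton.mpr
  exact ⟨u, by rw [hu]⟩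

/-- **The crux's shape.** An ideal `I = (g)` of `R₀⟦T⟧` containing `(L)`, with `g` free of norm-`1` coefficients
below degree `n` and `‖L_n‖ = 1`, equals `(L)`. In route UTD: `I = Ch_Λ(X_{∅,0}(E/K_∞))·R₀⟦T⟧`, `L` a BDP/LZZ
frame of `f_E`, the inclusion = one divisibility at `E`, the profile = transported `(μ, λ)`. [folklore] -/
theorem eq_span_of_span_le_of_normProfile {I : Ideal (UnrSeries p)} {g L : UnrSeries p} {n : ℕ}
    (hI : I = Ideal.span {g}) (hle : Ideal.span {L} ≤ I)
    (hg : ∀ i < n, ‖((PowerSeries.coeff i g : unrIntegers p) : ℂ_[p])‖ < 1)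
    (hL : ‖((PowerSeries.coeff n L : unrIntegers p) : ℂ_[p])‖ = 1) :
    I = Ideal.span {L} := by
  subst hI
  exact span_eq_span_of_dvd_of_normProfile
    (Ideal.mem_span_singleton.mp (hle (Ideal.mem_span_singleton_self L))) hg hL

end Summit.BirchSwinnertonDyer.BirchSwinnertonDyer.Theorems.UniversalToricDescentNormProfile

end
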